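import Mathlib
import Summits.Ventures.PercRepro2.SwAllLeafMark
import Summits.Ventures.PercRepro2.SwOutCrossJunctionSeriesExample

/-!
# The mark at a pendant vertex of a dropped vertex, on an instance (blind cell PercRepro2,
night-4 g27, 2026-08-28; proofs/NIGHT4-G27.md §12)

`crossEx7` is g24's `crossEx` with a pendant vertex `7` hanging at the dropped vertex `p₁ = 4`
(the edge `47`; ten edges on `Fin 8`), and THE MARK AT THE PENDANT VERTEX `o = 7`: a vertex without
an outside edge that no junction theorem admits and that cannot be peeled (it is the mark).  The
row with the mark at `4` holds — `7` is then an ordinary leaf, peeled by `Reducible.leaf`, and the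
peeled region is a cross junction with the mark at the dropped vertex `4` — and the leaf theorem
moves the mark to `7`: **`sw_crossEx7_leaf : Sw crossEx7 0 1 7`**.  The coverage census
(mining/night-4/g27/coverage.py, the `markpiece` line) counts such marks at +2.5 points of the
(graph, marking) pairs at n = 7.
-/

namespace Summit.Ventures.PercRepro2

namespace CrossArm

open Hull LocRows

/-- `crossEx` with a pendant vertex `7` at `p₁ = 4`: `l = 0`, `h = 1`, `u = 3`, `p₁ = 4`,
`p₂ = 5`, the u-arm `6`, the old mark `2`; the leaf edge is `9 = s(4, 7)`. -/
def crossEx7 : Fin 10 → Sym2 (Fin 8) :=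
  ![s(1, 6), s(3, 6), s(3, 4), s(3, 5), s(4, 5), s(6, 0), s(4, 0), s(5, 0), s(2, 0), s(4, 7)]

/-- The two dropped vertices. -/
def crossEx7P : Fin 2 → Fin 8 := ![4, 5]

/-- The region of the leaf step: `{l}ᶜ` without the pendant vertex. -/
abbrev crossEx7U : Set (Fin 8) := ({0}ᶜ : Set (Fin 8)) \ {7}

/-- `7` is a leaf at `4` through the edge `9`. -/
theorem crossEx7_leaf : IsLeafAt crossEx7 7 4 9 where
  ends₁ := by decide
  up := by decide
  only := by decide

/-- The peeled graph is a cross junction on the region without `7`, with the mark at the dropped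
vertex `4`. -/
theorem crossEx7D_junction :
    CrossJunctionM (deleteLeaf crossEx7 7 9) crossEx7U 1 3 crossEx7P (⊤ : SimpleGraph (Fin 2)) 4 where
  hne_hu := by decide
  hne_hp := by decide
  hne_up := by decide
  p_inj := by intro i j h; revert i j; decide
  hhU := by simp
  huU := by simp
  hpU := by
    intro i
    simp only [crossEx7U, Set.mem_sdiff, Set.mem_compl_iff, Set.mem_singleton_iff]
    revert i
    decide
  hloop_h := by decide
  hloop_u := by decide
  hnadj := by decide
  hnadj_p := by decide
  hup := by decide
  hcross := by decide
  hcross_adj := by decide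
  hcross_simple := by decide
  hu_adj_h := by decide
  hp_in := by
    intro i e x he hxU
    simp only [crossEx7U, Set.mem_sdiff, Set.mem_compl_iff, Set.mem_singleton_iff] at hxU
    revert i e x
    decide
  hout := by
    intro x hx hx1 hx2 hx3
    simp only [crossEx7U, Set.mem_sdiff, Set.mem_compl_iff, Set.mem_singleton_iff] at hx ⊢
    revert x
    decide
  hext_o := by
    intro i hi
    simp only [crossEx7U, Set.mem_sdiff, Set.mem_compl_iff, Set.mem_singleton_iff]
    revert i
    decide

open scoped Classical in
/-- **Row 2′SW-ALL on `crossEx7` with the mark at the dropped vertex `4`** (the pendant vertex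
peeled). -/
theorem swAll_crossEx7_dropped : SwAll crossEx7 0 1 4 := by
  refine swAll_of_reducible 0 1 4 (by decide) ?_
  refine Reducible.leaf crossEx7 ({0}ᶜ) 7 4 9 crossEx7_leaf (by simp) (by decide) (by decide)
    (by decide) ?_
  exact crossEx7D_junction.reducible (by simp)

open scoped Classical in
/-- **Row (SW) on `crossEx7` with the mark at the pendant vertex `7`** — by the leaf theorem from
the row with the mark at `4`. -/
theorem sw_crossEx7_leaf : Sw crossEx7 0 1 7 :=
  crossEx7_leaf.sw_leafMark (by decide) (by decide) swAll_crossEx7_dropped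

end CrossArm

end Summit.Ventures.PercRepro2
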